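import Literature.Geometry.Lorentzian.SpacelikePieceDomain
import Literature.Geometry.Lorentzian.OpensCausality
import HarnessLib

/-!
# Local Cauchy lenses: small globally hyperbolic neighbourhoods over a level set of a time function

Let `(M, g, τ)` be a time-oriented Lorentzian manifold, `a ∈ M`, and `f : M → ℝ` a `C¹` function
near `a` with `f a = 0` whose differential is positive on the future causal cone at `a` (a *local
time function*: `-grad f` is future timelike at `a`), and suppose the set `S ⊆ M` coincides near
`a` with the level set `{f = 0}`. Then **`a` has arbitrarily small open neighbourhoods `V` in which
`S ∩ V` is a Cauchy hypersurface of the open sub-spacetime `(V, g|_V, τ|_V)`**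
(`LorentzianMetric.exists_isCauchyHypersurface_restrict_of_timeFunction`).

These are the lens-shaped regions `𝒰` over a piece of a spacelike surface `ℋ(0) = {t = 0}` with
achronal boundary on which the energy inequalities of the local Cauchy problem are run
(Hawking–Ellis 1973, §7.4, p. 234, Fig. 48 and hypothesis (1) of Lemma 7.4.4: *"`∂𝒰 ∩ 𝒰̄₊` is
achronal"*; §4.3), here produced in the chart at `a` as
`V = {q : |f q| + k ‖φ q - φ a‖ < δ}` for a small slope `k` and height `δ`: along a future causal
curve the clock `f` increases at a rate `≥ (c/2) ‖ẋ‖` (uniform cone constant,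
`PushUp.exists_cone_const_functional`, and continuity of `df`), so that below `S` the quantity
`-f + k ‖x - x₀‖` decreases and above `S` the quantity `f + k ‖x - x₀‖` increases — a future
endless timelike curve of `V` which stayed below `S` would converge inside `V` (the displacement is
Lipschitz in the clock, `norm_sub_le_of_clock`, and `E` is complete), i.e. have an endpoint in `V`.
Hence every endless timelike curve of `V` reaches `{f ≥ 0}` and `{f ≤ 0}`, crosses `{f = 0} = S`
(intermediate values), and does so once (`f` is strictly increasing along it). This is the local,
chart-level counterpart of "the Cauchy development of an acausal hypersurface is globally
hyperbolic" (O'Neill 1983, Ch. 14, Thm. 14.38, Lemma 14.43) that the local existence and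
uniqueness theory of hyperbolic equations uses (Hawking–Ellis 1973, §7.4–7.5; it supplies the
Cauchy-hypersurface clause of the germ domains in
`CauchyDevelopment.exists_isCommonDevelopment_of_germs`, `CauchyProblemLocalUniquenessProofs`).

Everything is proved; no definitions, no named facts (D-0026).

## References

* S. W. Hawking, G. F. R. Ellis, *The large scale structure of space-time*, CUP 1973, §7.4,
  pp. 233–234 (the regions `𝒰`, `𝒰₊`, Fig. 48, Lemma 7.4.4 (1)), §6.6. [HawkingEllis1973CUP]
* B. O'Neill, *Semi-Riemannian geometry with applications to relativity*, Academic Press 1983,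
  Ch. 14, Thm. 14.38 and Lemma 14.43 (pp. 423–426); Ch. 5, Lemma 5.26 ff. [ONeillSemiRiemannian1983]
-/

noncomputable section

open Bundle Set Filter Function Topology TopologicalSpace
open scoped Manifold ContDiff Topology

namespace Literature.Geometry.Lorentzian

/-! ### Normed-space preliminaries -/

section Normed

variable {F : Type*} [NormedAddCommGroup F] [NormedSpace ℝ F]

/-- **Uniform cone constant for a covector positive on the future causal cone.** Let `G₀` be a
bilinear form, `T₀` a vector with `G₀(T₀, v) < 0`… — precisely: suppose the covector `ℓ` is
positive on every `v ≠ 0` with `G₀(v, v) ≤ 0` and `G₀(T₀, v) ≤ 0` (the closed future causal cone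
of `(G₀, T₀)`). Then there are `c, m > 0` such that for every bilinear form `G` and covector `t`
within `m` of `G₀` and `G₀(T₀, ·)`, every `v` with `G(v, v) ≤ 0` and `t(v) < 0` satisfies
`c ‖v‖ ≤ ℓ(v)`. The case `ℓ = -G₀(T₀, ·)` is `PushUp.exists_cone_const`; same proof (minimise `ℓ`
and `max (G₀(v,v)) (G₀(T₀,v))` over compact pieces of the unit sphere). O'Neill 1983, Ch. 5,
Lemma 5.26 ff. for the pointwise statements. [folklore] -/
theorem PushUp.exists_cone_const_functional [FiniteDimensional ℝ F] (G₀ : F →L[ℝ] F →L[ℝ] ℝ)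
    (T₀ : F) (ℓ : F →L[ℝ] ℝ) (hpos : ∀ v, v ≠ 0 → G₀ v v ≤ 0 → G₀ T₀ v ≤ 0 → 0 < ℓ v) :
    ∃ c > 0, ∃ m > 0, ∀ (G : F →L[ℝ] F →L[ℝ] ℝ) (t : F →L[ℝ] ℝ), ‖G - G₀‖ < m →
      ‖t - G₀ T₀‖ < m → ∀ v, G v v ≤ 0 → t v < 0 → c * ‖v‖ ≤ ℓ v := by
  have hS : IsCompact (Metric.sphere (0 : F) 1) := isCompact_sphere 0 1
  have hq : Continuous fun u : F ↦ G₀ u u :=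
    G₀.continuous₂.comp (continuous_id.prodMk continuous_id)
  have hl : Continuous fun u : F ↦ G₀ T₀ u := (G₀ T₀).continuous
  have hℓc : Continuous fun u : F ↦ ℓ u := ℓ.continuous
  -- Step 1: `ℓ u ≥ 2c` on the causal unit vectors
  obtain ⟨c, hc, hc'⟩ : ∃ c > 0, ∀ u ∈ Metric.sphere (0 : F) 1, G₀ u u ≤ 0 → G₀ T₀ u ≤ 0 →
      2 * c ≤ ℓ u := by
    set S₁ : Set F := Metric.sphere (0 : F) 1 ∩ {u | G₀ u u ≤ 0 ∧ G₀ T₀ u ≤ 0} with hS₁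
    have hS₁c : IsCompact S₁ := hS.inter_right
      ((isClosed_le hq continuous_const).inter (isClosed_le hl continuous_const))
    rcases S₁.eq_empty_or_nonempty with h | h
    · refine ⟨1, one_pos, fun u hu h1 h2 ↦ ?_⟩
      have : u ∈ S₁ := ⟨hu, h1, h2⟩
      rw [h] at this
      exact this.elim
    · obtain ⟨u₀, hu₀, hmin⟩ := hS₁c.exists_isMinOn h (f := fun u ↦ ℓ u) hℓc.continuousOn
      have hu₀1 : ‖u₀‖ = 1 := mem_sphere_zero_iff_norm.mp hu₀.1
      have hu₀0 : u₀ ≠ 0 := by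
        rintro rfl; simp at hu₀1
      have hf0 : 0 < ℓ u₀ := hpos u₀ hu₀0 hu₀.2.1 hu₀.2.2
      refine ⟨ℓ u₀ / 2, by positivity, fun u hu h1 h2 ↦ ?_⟩
      have := hmin (show u ∈ S₁ from ⟨hu, h1, h2⟩)
      simp only [mem_setOf_eq] at this
      linarith
  -- Step 2: away from those, `max (G₀ u u) (G₀ T₀ u) ≥ 2m`
  obtain ⟨m, hm, hm'⟩ : ∃ m > 0, ∀ u ∈ Metric.sphere (0 : F) 1, ℓ u ≤ c →
      2 * m ≤ max (G₀ u u) (G₀ T₀ u) := by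
    set S₂ : Set F := Metric.sphere (0 : F) 1 ∩ {u | ℓ u ≤ c} with hS₂
    have hS₂c : IsCompact S₂ := hS.inter_right (isClosed_le hℓc continuous_const)
    rcases S₂.eq_empty_or_nonempty with h | h
    · refine ⟨1, one_pos, fun u hu h1 ↦ ?_⟩
      have : u ∈ S₂ := ⟨hu, h1⟩
      rw [h] at this
      exact this.elim
    · obtain ⟨u₁, hu₁, hmin⟩ :=
        hS₂c.exists_isMinOn h (f := fun u ↦ max (G₀ u u) (G₀ T₀ u)) (hq.max hl).continuousOn
      have hΦ : 0 < max (G₀ u₁ u₁) (G₀ T₀ u₁) := by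
        by_contra hle
        have hle := not_lt.mp hle
        have h1 : G₀ u₁ u₁ ≤ 0 := (le_max_left _ _).trans hle
        have h2 : G₀ T₀ u₁ ≤ 0 := (le_max_right _ _).trans hle
        have h3 := hc' u₁ hu₁.1 h1 h2
        have h4 : ℓ u₁ ≤ c := hu₁.2
        linarith
      refine ⟨max (G₀ u₁ u₁) (G₀ T₀ u₁) / 2, by positivity, fun u hu h1 ↦ ?_⟩
      have := hmin (show u ∈ S₂ from ⟨hu, h1⟩)
      simp only [mem_setOf_eq] at this
      linarith
  refine ⟨c, hc, m, hm, fun G t hG ht v hvv htv ↦ ?_⟩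
  -- normalise `v`
  have hv0 : v ≠ 0 := by
    rintro rfl
    rw [map_zero] at htv
    exact lt_irrefl 0 htv
  set r : ℝ := ‖v‖ with hr
  have hr0 : 0 < r := norm_pos_iff.mpr hv0
  set u : F := r⁻¹ • v with hu
  have hu1 : u ∈ Metric.sphere (0 : F) 1 := by
    rw [mem_sphere_zero_iff_norm, hu, norm_smul, norm_inv, Real.norm_of_nonneg hr0.le,
      inv_mul_cancel₀ hr0.ne']
  have hun : ‖u‖ = 1 := mem_sphere_zero_iff_norm.mp hu1
  have hri : 0 ≤ r⁻¹ := inv_nonneg.mpr hr0.le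
  have hGuu : G u u = r⁻¹ * (r⁻¹ * G v v) := by
    simp only [hu, map_smul, FunLike.coe_smul, Pi.smul_apply, smul_eq_mul]
  have hGuu' : G u u ≤ 0 := by
    rw [hGuu]
    exact mul_nonpos_iff.mpr (Or.inl ⟨hri, mul_nonpos_iff.mpr (Or.inl ⟨hri, hvv⟩)⟩)
  have htu : t u < 0 := by
    have : t u = r⁻¹ * t v := by simp only [hu, map_smul, smul_eq_mul]
    rw [this]
    exact mul_neg_of_pos_of_neg (inv_pos.mpr hr0) htv
  -- compare with `G₀`
  have h1 : G₀ u u < m := by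
    have h2 : G₀ u u - G u u ≤ ‖G - G₀‖ * ‖u‖ * ‖u‖ := PushUp.bilin_sub_le' G₀ G u u
    rw [hun, mul_one, mul_one] at h2
    linarith
  have h2 : G₀ T₀ u < m := by
    have h3 : ‖(t - G₀ T₀) u‖ ≤ ‖t - G₀ T₀‖ * ‖u‖ := (t - G₀ T₀).le_opNorm u
    have h4 : (t - G₀ T₀) u = t u - G₀ T₀ u := rfl
    rw [hun, mul_one, h4, Real.norm_eq_abs] at h3
    linarith [neg_abs_le (t u - G₀ T₀ u)]
  have h3 : c < ℓ u := by
    by_contra hle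
    have hle := not_lt.mp hle
    have := hm' u hu1 hle
    have h4 : max (G₀ u u) (G₀ T₀ u) < m := max_lt h1 h2
    linarith
  -- scale back
  have h4 : ℓ u = r⁻¹ * ℓ v := by
    simp only [hu, map_smul, smul_eq_mul]
  rw [h4] at h3
  have h5 : c * r < ℓ v := by
    have := mul_lt_mul_of_pos_right h3 hr0
    rwa [mul_comm (r⁻¹) _, mul_assoc, inv_mul_cancel₀ hr0.ne', mul_one] at this
  exact h5.le

/-- **Displacement is controlled by a clock.** If the curve `x` has derivative `w s` and the real
function `h` has derivative `h' s` at every `s ∈ [s₁, s₂]`, with `c ‖w s‖ ≤ h' s`, then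
`c ‖x s₂ - x s₁‖ ≤ h s₂ - h s₁`: for a norming functional `μ` of `x s₂ - x s₁` (Hahn–Banach) the
function `h - c μ ∘ x` has nonnegative derivative. (`cone_estimate_of_hasDerivAt` is the case of
a linear clock `h = ℓ ∘ x`.) [folklore] -/
theorem norm_sub_le_of_clock {c : ℝ} (hc : 0 ≤ c) {x w : ℝ → F} {h h' : ℝ → ℝ}
    {s₁ s₂ : ℝ} (hs : s₁ ≤ s₂) (hx : ∀ s ∈ Icc s₁ s₂, HasDerivAt x (w s) s)
    (hh : ∀ s ∈ Icc s₁ s₂, HasDerivAt h (h' s) s)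
    (hw : ∀ s ∈ Icc s₁ s₂, c * ‖w s‖ ≤ h' s) :
    c * ‖x s₂ - x s₁‖ ≤ h s₂ - h s₁ := by
  obtain ⟨μ, hμ1, hμx⟩ := exists_dual_vector'' ℝ (x s₂ - x s₁)
  set φ : ℝ → ℝ := fun s ↦ h s - c * μ (x s) with hφ
  have hφ' : ∀ s ∈ Icc s₁ s₂, HasDerivAt φ (h' s - c * μ (w s)) s := fun s hs ↦
    (hh s hs).sub ((μ.hasFDerivAt.comp_hasDerivAt s (hx s hs)).const_mul c)
  have hnonneg : ∀ s ∈ Icc s₁ s₂, 0 ≤ h' s - c * μ (w s) := by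
    intro s hs
    have h1 : μ (w s) ≤ ‖w s‖ := by
      have h := μ.le_opNorm (w s)
      have h' : ‖μ (w s)‖ ≤ ‖w s‖ := h.trans (by nlinarith [norm_nonneg (w s)])
      exact (le_abs_self _).trans (Real.norm_eq_abs _ ▸ h')
    nlinarith [hw s hs]
  have hmono : MonotoneOn φ (Icc s₁ s₂) := by
    refine monotoneOn_of_deriv_nonneg (convex_Icc s₁ s₂)
      (fun s hs ↦ (hφ' s hs).continuousAt.continuousWithinAt) (fun s hs ↦ ?_) (fun s hs ↦ ?_)
    · rw [interior_Icc] at hs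
      exact (hφ' s ⟨hs.1.le, hs.2.le⟩).differentiableAt.differentiableWithinAt
    · rw [interior_Icc] at hs
      rw [(hφ' s ⟨hs.1.le, hs.2.le⟩).deriv]
      exact hnonneg s ⟨hs.1.le, hs.2.le⟩
  have h := hmono (left_mem_Icc.2 hs) (right_mem_Icc.2 hs) hs
  simp only [hφ] at h
  have hμ' : μ (x s₂ - x s₁) = ‖x s₂ - x s₁‖ := by exact_mod_cast hμx
  rw [map_sub] at hμ'
  nlinarith [hμ', h]

omit [NormedSpace ℝ F] in
/-- **A curve whose displacement is controlled by a convergent clock converges** (in a complete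
space): if `dist (x i) (x j) ≤ C |h i - h j|` and `h` tends to a limit along a filter, then so
does `x` (it is Cauchy along the filter). [folklore] -/
theorem exists_tendsto_of_dist_le_clock [CompleteSpace F] {ι : Type*} {l : Filter ι} [l.NeBot]
    {x : ι → F} {h : ι → ℝ} {C L : ℝ} (hh : Tendsto h l (𝓝 L))
    (hx : ∀ i j, dist (x i) (x j) ≤ C * |h i - h j|) : ∃ e, Tendsto x l (𝓝 e) := by
  have hC : ∀ i j, dist (x i) (x j) ≤ (|C| + 1) * |h i - h j| := fun i j ↦
    (hx i j).trans (mul_le_mul_of_nonneg_right (by linarith [le_abs_self C]) (abs_nonneg _))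
  have hcau : Cauchy (l.map x) := by
    refine Metric.cauchy_iff.2 ⟨inferInstance, fun ε hε ↦ ?_⟩
    have hε' : 0 < ε / (2 * (|C| + 1)) := by positivity
    refine ⟨x '' {i | dist (h i) L < ε / (2 * (|C| + 1))}, image_mem_map
      (Metric.tendsto_nhds.1 hh _ hε'), ?_⟩
    rintro _ ⟨i, hi, rfl⟩ _ ⟨j, hj, rfl⟩
    have hi' : |h i - L| < ε / (2 * (|C| + 1)) := by rw [← Real.dist_eq]; exact hi
    have hj' : |h j - L| < ε / (2 * (|C| + 1)) := by rw [← Real.dist_eq]; exact hj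
    have hij : |h i - h j| < ε / (|C| + 1) := by
      have h1 : |h i - h j| ≤ |h i - L| + |h j - L| := by
        rw [← abs_sub_comm L (h j)]
        exact (abs_sub_le (h i) L (h j))
      have hpos' : (0 : ℝ) < |C| + 1 := by positivity
      have h2 : ε / (2 * (|C| + 1)) + ε / (2 * (|C| + 1)) = ε / (|C| + 1) := by
        field_simp
        ring
      linarith
    have hpos : 0 < |C| + 1 := by positivity
    calc dist (x i) (x j) ≤ (|C| + 1) * |h i - h j| := hC i j
      _ < (|C| + 1) * (ε / (|C| + 1)) := mul_lt_mul_of_pos_left hij hpos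
      _ = ε := by field_simp
  obtain ⟨e, he⟩ := CompleteSpace.complete hcau
  exact ⟨e, he⟩

/-- **One-sided crossing lemma for a curve in a lens.** Let `x` be a curve in `F` on the parameter
interval `J` with derivative `w`, and `h = Φ ∘ x` a clock along it with derivative `h' ≥ c ‖w‖`
(`c > 0`). Suppose the curve stays in the lens `{‖· - x₀‖ < ρ, |Φ| + k ‖· - x₀‖ < δ}` with slope
`2k ≤ c`, `Φ` continuous on the closed ball. Then either the clock becomes nonnegative somewhere
on `J`, or the curve has a future endpoint `e` with `‖e - x₀‖ ≤ ρ` and `|Φ e| + k ‖e - x₀‖ < δ`: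
while `h < 0`, the clock is increasing and bounded, hence convergent along `J`; the displacement is
Lipschitz in the clock (`norm_sub_le_of_clock`), so the curve converges (`exists_tendsto_of_dist_le_clock`);
and `-h + k ‖x - x₀‖` is nonincreasing, which places the limit in the (half-closed) lens. This is
the mechanism by which the regions `𝒰` of Hawking–Ellis 1973, §7.4 (Fig. 48) trap future timelike
curves below `ℋ(0)`. [folklore] -/
theorem exists_clock_nonneg_or_hasFutureEndpoint [CompleteSpace F] {x w : ℝ → F} {h h' : ℝ → ℝ}
    {J : Set ℝ} (hJ : J.OrdConnected) (hJne : J.Nonempty) {c k δ ρ : ℝ} (hc : 0 < c)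
    (hk : 0 ≤ k) (hkc : 2 * k ≤ c) {x₀ : F} {Φ : F → ℝ}
    (hΦ : ContinuousOn Φ (Metric.closedBall x₀ ρ))
    (hx : ∀ s ∈ J, HasDerivAt x (w s) s) (hh : ∀ s ∈ J, HasDerivAt h (h' s) s)
    (hw : ∀ s ∈ J, c * ‖w s‖ ≤ h' s) (hhΦ : ∀ s ∈ J, h s = Φ (x s))
    (hK : ∀ s ∈ J, ‖x s - x₀‖ < ρ ∧ |Φ (x s)| + k * ‖x s - x₀‖ < δ) :
    (∃ s ∈ J, 0 ≤ h s) ∨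
      ∃ e, ‖e - x₀‖ ≤ ρ ∧ |Φ e| + k * ‖e - x₀‖ < δ ∧ HasFutureEndpoint x J e := by
  by_cases hex : ∃ s ∈ J, 0 ≤ h s
  · exact Or.inl hex
  right
  push Not at hex
  haveI : Nonempty J := hJne.to_subtype
  -- the displacement estimate and monotonicity of the clock
  have hdisp : ∀ s₁ ∈ J, ∀ s₂ ∈ J, s₁ ≤ s₂ → c * ‖x s₂ - x s₁‖ ≤ h s₂ - h s₁ :=
    fun s₁ hs₁ s₂ hs₂ h12 ↦ norm_sub_le_of_clock hc.le h12 (fun s hs ↦ hx s (hJ.out hs₁ hs₂ hs))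
      (fun s hs ↦ hh s (hJ.out hs₁ hs₂ hs)) (fun s hs ↦ hw s (hJ.out hs₁ hs₂ hs))
  have hmono : ∀ s₁ ∈ J, ∀ s₂ ∈ J, s₁ ≤ s₂ → h s₁ ≤ h s₂ := fun s₁ hs₁ s₂ hs₂ h12 ↦ by
    have h1 := hdisp s₁ hs₁ s₂ hs₂ h12
    nlinarith [norm_nonneg (x s₂ - x s₁)]
  -- the clock converges along `J`
  set hJf : J → ℝ := fun s ↦ h s with hhJf
  have hmono' : Monotone hJf := fun s₁ s₂ h12 ↦ hmono s₁ s₁.2 s₂ s₂.2 h12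
  have hbdd : BddAbove (range hJf) := ⟨0, by rintro _ ⟨s, rfl⟩; exact (hex s s.2).le⟩
  set L : ℝ := ⨆ s : J, hJf s with hL_def
  have hL : Tendsto hJf atTop (𝓝 L) := tendsto_atTop_ciSup hmono' hbdd
  have hL0 : L ≤ 0 := ciSup_le fun s ↦ (hex s s.2).le
  -- hence the curve converges
  have hdist : ∀ i j : J, dist (x i) (x j) ≤ c⁻¹ * |hJf i - hJf j| := by
    intro i j
    rw [inv_mul_eq_div, le_div_iff₀ hc, mul_comm]
    rcases le_total (i : ℝ) j with hij | hij
    · have h1 := hdisp i i.2 j j.2 hij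
      rw [dist_comm, dist_eq_norm]
      exact h1.trans (by rw [abs_sub_comm]; exact le_abs_self _)
    · have h1 := hdisp j j.2 i i.2 hij
      rw [dist_eq_norm]
      exact h1.trans (le_abs_self _)
  obtain ⟨e, he⟩ := exists_tendsto_of_dist_le_clock hL hdist
  -- the limit lies within `ρ` of `x₀`
  have hball : ∀ s : J, x s ∈ Metric.closedBall x₀ ρ := fun s ↦
    Metric.mem_closedBall.2 (by rw [dist_eq_norm]; exact (hK s s.2).1.le)
  have he1 : ‖e - x₀‖ ≤ ρ := by
    have hmem := Metric.isClosed_closedBall.mem_of_tendsto he (Eventually.of_forall hball)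
    rwa [Metric.mem_closedBall, dist_eq_norm] at hmem
  -- `Φ e = L`
  have hΦe : Φ e = L := by
    have hew : Tendsto (fun s : J ↦ x s) atTop (𝓝[Metric.closedBall x₀ ρ] e) :=
      tendsto_nhdsWithin_iff.2 ⟨he, Eventually.of_forall hball⟩
    have h1 : Tendsto (fun s : J ↦ Φ (x s)) atTop (𝓝 (Φ e)) :=
      (hΦ e (Metric.mem_closedBall.2 (by rw [dist_eq_norm]; exact he1))).tendsto.comp hew
    have h2 : Tendsto (fun s : J ↦ Φ (x s)) atTop (𝓝 L) := hL.congr fun s ↦ hhΦ s s.2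
    exact tendsto_nhds_unique h1 h2
  -- `-h + k ‖x - x₀‖` is nonincreasing along the curve
  obtain ⟨s₀, hs₀⟩ := hJne
  have hQ : ∀ s ∈ J, s₀ ≤ s → -h s + k * ‖x s - x₀‖ ≤ -h s₀ + k * ‖x s₀ - x₀‖ := by
    intro s hs h0s
    have h1 := hdisp s₀ hs₀ s hs h0s
    have h2 : ‖x s - x₀‖ ≤ ‖x s - x s₀‖ + ‖x s₀ - x₀‖ := norm_sub_le_norm_sub_add_norm_sub _ _ _
    have h3 : k * ‖x s - x s₀‖ ≤ (h s - h s₀) / 2 := by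
      have h4 : k * ‖x s - x s₀‖ ≤ (c / 2) * ‖x s - x s₀‖ :=
        mul_le_mul_of_nonneg_right (by linarith) (norm_nonneg _)
      linarith
    have h5 := mul_le_mul_of_nonneg_left h2 hk
    have h6 := hmono s₀ hs₀ s hs h0s
    nlinarith
  have hQ0 : -h s₀ + k * ‖x s₀ - x₀‖ < δ := by
    have h1 := (hK s₀ hs₀).2
    rwa [← hhΦ s₀ hs₀, abs_of_neg (hex s₀ hs₀)] at h1
  have hQlim : Tendsto (fun s : J ↦ -hJf s + k * ‖x s - x₀‖) atTop (𝓝 (-L + k * ‖e - x₀‖)) :=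
    hL.neg.add (((he.sub_const x₀).norm).const_mul k)
  have hQe : -L + k * ‖e - x₀‖ ≤ -h s₀ + k * ‖x s₀ - x₀‖ :=
    le_of_tendsto hQlim (Filter.eventually_atTop.2 ⟨⟨s₀, hs₀⟩, fun s hs ↦ hQ s s.2 hs⟩)
  refine ⟨e, he1, ?_, he⟩
  rw [hΦe, abs_of_nonpos hL0]
  linarith

end Normed

/-! ### The lens lemma on the manifold -/

variable {E : Type*} [NormedAddCommGroup E] [NormedSpace ℝ E] {H : Type*} [TopologicalSpace H]
  {I : ModelWithCorners ℝ E H} {n : ℕ∞ω} {M : Type*} [TopologicalSpace M] [ChartedSpace H M]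
  [IsManifold I ∞ M]

namespace LorentzianMetric

variable {g : LorentzianMetric I n M} {τ : TimeOrientation g}

/-- **Local Cauchy lenses.** Let `(M, g, τ)` be a time-oriented `Cⁿ` (`n ≥ 1`) Lorentzian manifold
without boundary, of finite dimension, `a ∈ M`, and `f : M → ℝ` of class `C¹` at `a` with
`f a = 0` and `df_a(v) > 0` for every future-directed causal `v ∈ T_aM` (a local time function).
Let `S ⊆ M` agree with the level set `{f = 0}` near `a`. Then for every neighbourhood `W` of `a`
there is an open `V`, `a ∈ V ⊆ W`, such that `S ∩ V` is a Cauchy hypersurface of the open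
sub-spacetime `(V, g|_V, τ|_V)`: in the chart at `a`, `V = {|f| + k ‖φ - φ a‖ < δ}` for small `k`,
`δ` (the lens-shaped regions `𝒰` with achronal `∂𝒰 ∩ 𝒰̄₊` of Hawking–Ellis 1973, §7.4, p. 234,
Lemma 7.4.4 (1), Fig. 48). Along a future timelike curve of `V` the clock `f` increases at rate
`≥ (c/2) ‖ẋ‖` (`PushUp.exists_cone_const_functional`, continuity of `df` and of the coordinate
metric), so an endless timelike curve of `V` reaches `{f ≥ 0}` and `{f ≤ 0}`
(`exists_clock_nonneg_or_hasFutureEndpoint` for the curve and for its reversal: the alternative,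
an endpoint inside `V`, is excluded by endlessness), hence crosses `{f = 0} = S`, exactly once
(`f` is strictly increasing along it). The local counterpart of O'Neill 1983, Ch. 14, Thm. 14.38 /
Lemma 14.43. [cite: HawkingEllis1973CUP, §7.4, p. 234, Lemma 7.4.4 (1) and Fig. 48]
[cite: ONeillSemiRiemannian1983, Ch. 14, Thm. 14.38 and Lemma 14.43 (pp. 423–426)] -/
theorem exists_isCauchyHypersurface_restrict_of_timeFunction [BoundarylessManifold I M]
    [FiniteDimensional ℝ E] (hn : 1 ≤ n)
    (hres : PseudoRiemannianMetric.contMDiff_restrict (I := I) (n := n) (M := M))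
    (hτ : τ.contMDiff_restrict) {S : Set M} {a : M} {f : M → ℝ}
    (hf : ContMDiffAt I 𝓘(ℝ, ℝ) 1 f a) (hfa : f a = 0)
    (hdf : ∀ v : TangentSpace I a, τ.IsFutureDirected v → (0 : ℝ) < mfderiv I 𝓘(ℝ, ℝ) f a v)
    (hS : ∀ᶠ q in 𝓝 a, q ∈ S ↔ f q = 0) {W : Set M} (hW : W ∈ 𝓝 a) :
    ∃ V : Opens M, a ∈ V ∧ (V : Set M) ⊆ W ∧
      (g.restrict hres V).IsCauchyHypersurface (τ.restrict hres hτ V) (Subtype.val ⁻¹' S) := by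
  classical
  haveI : CompleteSpace E := FiniteDimensional.complete ℝ E
  -- notation and basic facts at `a`
  set φ := extChartAt I a with hφ
  set x₀ : E := φ a with hx₀
  set eT := trivializationAt E (TangentSpace I) a with heT
  have hx₀t : x₀ ∈ φ.target := mem_extChartAt_target a
  have hx₀int : x₀ ∈ interior (range I) := BoundarylessManifold.isInteriorPoint (I := I) (M := M)
  have hrange : range I ∈ 𝓝 x₀ := mem_interior_iff_mem_nhds.mp hx₀int
  have htarget : φ.target ∈ 𝓝 x₀ := by
    have hint : x₀ ∈ interior (extChartAt I a).target :=
      ModelWithCorners.isInteriorPoint_iff.mp (BoundarylessManifold.isInteriorPoint (I := I))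
    exact mem_interior_iff_mem_nhds.mp hint
  have hsymm₀ : φ.symm x₀ = a := extChartAt_to_inv a
  have hsrc₀ : a ∈ φ.source := mem_extChartAt_source a
  have hsrc_eq : φ.source = (chartAt H a).source := extChartAt_source I a
  have hid : ∀ w : E, eT.symmL ℝ a w = w := symmL_trivializationAt_base a
  -- the clock in the chart: `F = f ∘ φ⁻¹` is `C¹` at `x₀`
  set F : E → ℝ := f ∘ φ.symm with hF_def
  have hF : ContDiffAt ℝ 1 F x₀ := by
    have hf' : ContMDiffAt I 𝓘(ℝ, ℝ) 1 f (φ.symm x₀) := by rw [hsymm₀]; exact hf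
    have h1 : ContMDiffWithinAt 𝓘(ℝ, E) 𝓘(ℝ, ℝ) 1 F (range I) x₀ :=
      hf'.comp_contMDiffWithinAt x₀ (contMDiffWithinAt_extChartAt_symm_range a hx₀t)
    exact (contMDiffWithinAt_iff_contDiffWithinAt.1 h1).contDiffAt hrange
  obtain ⟨f', u, hu, hf'c, hf'⟩ := contDiffAt_one_iff.1 hF
  set ℓ : E →L[ℝ] ℝ := f' x₀ with hℓ_def
  have hF0 : HasFDerivAt F ℓ x₀ := hf' x₀ (mem_of_mem_nhds hu)
  -- `ℓ` is the differential of `f` at `a` read in the chart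
  have hℓ : ∀ w : E, ℓ w = mfderiv I 𝓘(ℝ, ℝ) f a w := by
    intro w
    have hfd : MDifferentiableAt I 𝓘(ℝ, ℝ) f a := hf.mdifferentiableAt (by simp)
    have e1 : mfderiv I 𝓘(ℝ, ℝ) f a w =
        fderivWithin ℝ (writtenInExtChartAt I 𝓘(ℝ, ℝ) a f) (range I) (φ a) w :=
      DFunLike.congr_fun hfd.mfderiv w
    have hw : writtenInExtChartAt I 𝓘(ℝ, ℝ) a f = F := by
      funext y
      show (extChartAt 𝓘(ℝ, ℝ) (f a)) (f (φ.symm y)) = f (φ.symm y)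
      rw [extChartAt_model_space_eq_id]
      rfl
    rw [e1, hw, fderivWithin_of_mem_nhds hrange, hF0.fderiv]
  -- `ℓ` is positive on the future causal cone of the coordinate metric at `x₀`
  have hpos : ∀ v : E, v ≠ 0 → g.coordMetric a x₀ v v ≤ 0 →
      g.coordMetric a x₀ (τ.coordTime a x₀) v ≤ 0 → 0 < ℓ v := by
    intro v hv0 hvv hTv
    have hcaus : g.IsCausal (eT.symmL ℝ (φ.symm x₀) v) := (isCausal_symmL_iff hx₀t v).2 ⟨hvv, hv0⟩
    have hTv' : g.coordMetric a x₀ (τ.coordTime a x₀) v < 0 := by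
      refine lt_of_le_of_ne hTv fun h0 ↦ ?_
      rw [coordMetric_coordTime_apply hx₀t] at h0
      exact g.val_ne_zero_of_isTimelike_of_isCausal (τ.isTimelike _) hcaus h0
    have hfut : τ.IsFutureDirected (eT.symmL ℝ (φ.symm x₀) v) :=
      (isFutureDirected_symmL_iff hx₀t v).2 ⟨⟨hvv, hv0⟩, hTv'⟩
    rw [show (extChartAt I a).symm x₀ = a from hsymm₀, hid] at hfut
    rw [hℓ]
    exact hdf v hfut
  -- Step 1: the uniform cone constant
  obtain ⟨c, hc, m, hm, hcone⟩ :=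
    PushUp.exists_cone_const_functional (g.coordMetric a x₀) (τ.coordTime a x₀) ℓ hpos
  -- Step 2: a chart radius `ρ` collecting all local requirements
  have hGc : ContinuousAt (g.coordMetric a) x₀ :=
    ((g.contDiffOn_coordMetric hn a).continuousOn.continuousWithinAt hx₀t).continuousAt htarget
  have hTc : ContinuousAt (τ.coordTime a) x₀ := (τ.continuousOn_coordTime hn a).continuousAt htarget
  have hGTc : ContinuousAt (fun x ↦ g.coordMetric a x (τ.coordTime a x)) x₀ := hGc.clm_apply hTc
  have hf'c₀ : ContinuousAt f' x₀ := hf'c.continuousAt hu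
  have hsymmc : ContinuousAt φ.symm x₀ := continuousAt_extChartAt_symm a
  have hW' : W ∈ 𝓝 (φ.symm x₀) := by rw [hsymm₀]; exact hW
  have hS' : {q | q ∈ S ↔ f q = 0} ∈ 𝓝 (φ.symm x₀) := by rw [hsymm₀]; exact hS
  obtain ⟨ρ, hρ, hball⟩ : ∃ ρ > 0, ∀ x : E, ‖x - x₀‖ < ρ → x ∈ φ.target ∧ x ∈ u ∧
      ‖g.coordMetric a x - g.coordMetric a x₀‖ < m ∧
      ‖g.coordMetric a x (τ.coordTime a x) - g.coordMetric a x₀ (τ.coordTime a x₀)‖ < m ∧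
      ‖f' x - ℓ‖ ≤ c / 2 ∧ φ.symm x ∈ W ∧ (φ.symm x ∈ S ↔ f (φ.symm x) = 0) := by
    have h1 : ∀ᶠ x in 𝓝 x₀, ‖g.coordMetric a x - g.coordMetric a x₀‖ < m := by
      obtain ⟨δ', hδ', hδ''⟩ := (NormedAddCommGroup.tendsto_nhds_nhds (f := g.coordMetric a)
        (x := x₀) (y := g.coordMetric a x₀)).1 hGc.tendsto m hm
      exact Metric.eventually_nhds_iff.2 ⟨δ', hδ', fun y hy ↦ hδ'' y (by rwa [← dist_eq_norm])⟩
    have h2 : ∀ᶠ x in 𝓝 x₀, ‖g.coordMetric a x (τ.coordTime a x) -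
        g.coordMetric a x₀ (τ.coordTime a x₀)‖ < m := by
      obtain ⟨δ', hδ', hδ''⟩ := (NormedAddCommGroup.tendsto_nhds_nhds
        (f := fun x ↦ g.coordMetric a x (τ.coordTime a x)) (x := x₀)
        (y := g.coordMetric a x₀ (τ.coordTime a x₀))).1 hGTc.tendsto m hm
      exact Metric.eventually_nhds_iff.2 ⟨δ', hδ', fun y hy ↦ hδ'' y (by rwa [← dist_eq_norm])⟩
    have h3 : ∀ᶠ x in 𝓝 x₀, ‖f' x - ℓ‖ ≤ c / 2 := by
      obtain ⟨δ', hδ', hδ''⟩ := (NormedAddCommGroup.tendsto_nhds_nhds (f := f') (x := x₀)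
        (y := f' x₀)).1 hf'c₀.tendsto (c / 2) (by positivity)
      exact Metric.eventually_nhds_iff.2
        ⟨δ', hδ', fun y hy ↦ (hδ'' y (by rwa [← dist_eq_norm])).le⟩
    have h4 : ∀ᶠ x in 𝓝 x₀, φ.symm x ∈ W := hsymmc.preimage_mem_nhds hW'
    have h5 : ∀ᶠ x in 𝓝 x₀, (φ.symm x ∈ S ↔ f (φ.symm x) = 0) := hsymmc.preimage_mem_nhds hS'
    have ht' : ∀ᶠ x in 𝓝 x₀, x ∈ φ.target := htarget
    have hu' : ∀ᶠ x in 𝓝 x₀, x ∈ u := hu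
    obtain ⟨ρ, hρ, hρ'⟩ := Metric.eventually_nhds_iff.1
      ((((ht'.and hu').and (h1.and h2)).and (h3.and (h4.and h5))))
    refine ⟨ρ, hρ, fun x hx ↦ ?_⟩
    have h := hρ' (y := x) (by rw [dist_eq_norm]; exact hx)
    exact ⟨h.1.1.1, h.1.1.2, h.1.2.1, h.1.2.2, h.2.1, h.2.2.1, h.2.2.2⟩
  -- consequences on the ball
  have hFd : ∀ x : E, ‖x - x₀‖ < ρ → HasFDerivAt F (f' x) x := fun x hx ↦ hf' x (hball x hx).2.1
  -- Step 3: the lens `Kset` and the open set `V`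
  set k : ℝ := c / 4 with hk
  have hkpos : 0 < k := by positivity
  set ρ' : ℝ := ρ / 2 with hρ'
  have hρ'pos : 0 < ρ' := by positivity
  have hρ'ρ : ρ' < ρ := by rw [hρ']; linarith
  set δ : ℝ := k * (ρ' / 2) with hδ
  have hδpos : 0 < δ := by positivity
  set Q : E → ℝ := fun x ↦ |F x| + k * ‖x - x₀‖ with hQ
  set Kset : Set E := {x | ‖x - x₀‖ < ρ' ∧ Q x < δ} with hKset
  have hKsub : ∀ x ∈ Kset, ‖x - x₀‖ < ρ' / 2 := by
    rintro x ⟨-, hx⟩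
    have h1 : k * ‖x - x₀‖ < k * (ρ' / 2) := by
      have : k * ‖x - x₀‖ ≤ Q x := by simp only [hQ]; linarith [abs_nonneg (F x)]
      linarith
    exact lt_of_mul_lt_mul_left h1 hkpos.le
  have hKρ : ∀ x ∈ Kset, ‖x - x₀‖ < ρ := fun x hx ↦ (hKsub x hx).trans (by linarith)
  have hQc : ContinuousOn Q (Metric.ball x₀ ρ') := by
    intro x hx
    have hx' : ‖x - x₀‖ < ρ := by
      rw [Metric.mem_ball, dist_eq_norm] at hx; exact hx.trans hρ'ρ
    exact (((hFd x hx').continuousAt.abs).add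
      ((continuous_const.mul (continuous_id.sub continuous_const).norm).continuousAt)).continuousWithinAt
  have hKopen : IsOpen Kset := by
    have hKeq : Kset = Metric.ball x₀ ρ' ∩ Q ⁻¹' Iio δ := by
      ext x
      simp only [hKset, mem_setOf_eq, mem_inter_iff, Metric.mem_ball, dist_eq_norm, mem_preimage,
        mem_Iio]
    rw [hKeq]
    exact hQc.isOpen_inter_preimage Metric.isOpen_ball isOpen_Iio
  have hx₀K : x₀ ∈ Kset := by
    refine ⟨by rw [sub_self, norm_zero]; exact hρ'pos, ?_⟩
    show |F x₀| + k * ‖x₀ - x₀‖ < δ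
    have : F x₀ = 0 := by show f (φ.symm x₀) = 0; rw [hsymm₀]; exact hfa
    rw [this, sub_self, norm_zero, abs_zero, mul_zero, add_zero]
    exact hδpos
  set V : Opens M := ⟨φ.source ∩ φ ⁻¹' Kset,
    (continuousOn_extChartAt a).isOpen_inter_preimage (isOpen_extChartAt_source a) hKopen⟩ with hV
  have hmemV : ∀ {q : M}, q ∈ V ↔ q ∈ φ.source ∧ φ q ∈ Kset := fun {q} ↦ Iff.rfl
  refine ⟨V, hmemV.2 ⟨hsrc₀, hx₀K⟩, fun q hq ↦ ?_, ?_⟩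
  · -- `V ⊆ W`
    obtain ⟨hq1, hq2⟩ := hmemV.1 hq
    have h := (hball (φ q) (hKρ _ hq2)).2.2.2.2.2.1
    rwa [φ.left_inv hq1] at h
  -- Step 4: the Cauchy property
  intro γ J hγ
  obtain ⟨hJ, hγt, hγf, hγp⟩ := hγ
  set γM : ℝ → M := Subtype.val ∘ γ with hγM_def
  have hγM : g.IsFutureTimelikeCurveOn τ γM J :=
    (isFutureTimelikeCurveOn_restrict_iff g τ hres hτ V).1 hγt
  have hγV : ∀ s, γM s ∈ φ.source ∧ φ (γM s) ∈ Kset := fun s ↦ hmemV.1 (γ s).2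
  -- the coordinate curve and its velocity
  set xc : ℝ → E := fun s ↦ φ (γM s) with hxc
  set wc : ℝ → E := fun s ↦ eT.continuousLinearMapAt ℝ (γM s) (velocity I γM s) with hwc
  have hxcK : ∀ s, xc s ∈ Kset := fun s ↦ (hγV s).2
  have hxcρ : ∀ s, ‖xc s - x₀‖ < ρ := fun s ↦ hKρ _ (hxcK s)
  have hleft : ∀ s, φ.symm (xc s) = γM s := fun s ↦ φ.left_inv (hγV s).1
  have hderiv : ∀ s ∈ J, HasDerivAt xc (wc s) s := fun s hs ↦
    hasDerivAt_extChartAt_comp_continuousLinearMapAt (p := a) (hγM s hs).1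
      (by rw [← hsrc_eq]; exact (hγV s).1)
  have hcoord : ∀ s ∈ J, (g.coordMetric a (xc s) (wc s) (wc s) ≤ 0 ∧ wc s ≠ 0) ∧
      g.coordMetric a (xc s) (τ.coordTime a (xc s)) (wc s) < 0 := fun s hs ↦
    (isFutureDirected_iff_coord (τ := τ) (p := a) (by rw [← hsrc_eq]; exact (hγV s).1)
      (velocity I γM s)).1 (hγM s hs).2.2
  have hcone' : ∀ s ∈ J, c * ‖wc s‖ ≤ ℓ (wc s) := fun s hs ↦ by
    obtain ⟨-, -, hGx, hGTx, -⟩ := hball (xc s) (hxcρ s)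
    exact hcone _ _ hGx hGTx (wc s) (hcoord s hs).1.1 (hcoord s hs).2
  -- the clock along the curve
  set h : ℝ → ℝ := fun s ↦ F (xc s) with hh_def
  have hhf : ∀ s, h s = f (γM s) := fun s ↦ by
    show f (φ.symm (xc s)) = f (γM s); rw [hleft]
  have hh : ∀ s ∈ J, HasDerivAt h (f' (xc s) (wc s)) s := fun s hs ↦
    (hFd (xc s) (hxcρ s)).comp_hasDerivAt s (hderiv s hs)
  have hrate : ∀ s ∈ J, c / 2 * ‖wc s‖ ≤ f' (xc s) (wc s) := fun s hs ↦ by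
    have h1 := hcone' s hs
    have h2 : ‖f' (xc s) - ℓ‖ ≤ c / 2 := (hball (xc s) (hxcρ s)).2.2.2.2.1
    have h3 : |(f' (xc s) - ℓ) (wc s)| ≤ c / 2 * ‖wc s‖ := by
      rw [← Real.norm_eq_abs]
      exact ((f' (xc s) - ℓ).le_opNorm (wc s)).trans (mul_le_mul_of_nonneg_right h2 (norm_nonneg _))
    have h4 : (f' (xc s) - ℓ) (wc s) = f' (xc s) (wc s) - ℓ (wc s) := rfl
    rw [h4] at h3
    linarith [neg_abs_le (f' (xc s) (wc s) - ℓ (wc s))]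
  have hratepos : ∀ s ∈ J, 0 < f' (xc s) (wc s) := fun s hs ↦ by
    have h1 : 0 < ‖wc s‖ := norm_pos_iff.2 (hcoord s hs).1.2
    have := hrate s hs
    nlinarith
  -- the clock is strictly increasing along `J`
  have hcont : ContinuousOn h J := fun s hs ↦ (hh s hs).continuousAt.continuousWithinAt
  have hmono : StrictMonoOn h J := by
    refine strictMonoOn_of_deriv_pos hJ.convex hcont fun s hs ↦ ?_
    have hs' : s ∈ J := interior_subset hs
    rw [(hh s hs').deriv]
    exact hratepos s hs'
  have hJne : J.Nonempty := hγf.1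
  -- continuity of `F` on the closed half-ball
  have hFc : ContinuousOn F (Metric.closedBall x₀ (ρ' / 2)) := fun x hx ↦ by
    have hx' : ‖x - x₀‖ < ρ := by
      rw [Metric.mem_closedBall, dist_eq_norm] at hx; linarith
    exact (hFd x hx').continuousAt.continuousWithinAt
  have hFc' : ContinuousOn (fun x ↦ -F x) (Metric.closedBall x₀ (ρ' / 2)) := hFc.neg
  have hk2 : 2 * k ≤ c / 2 := by rw [hk]; linarith
  -- a limit point of the coordinate curve inside the half-closed lens gives an endpoint in `V`
  have hlim : ∀ e : E, ‖e - x₀‖ ≤ ρ' / 2 → |F e| + k * ‖e - x₀‖ < δ →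
      ∃ hq : φ.symm e ∈ V, ∀ {l : Filter J}, Tendsto (fun s : J ↦ xc s) l (𝓝 e) →
        Tendsto (fun s : J ↦ γ s) l (𝓝 ⟨φ.symm e, hq⟩) := by
    intro e he1 he2
    have heK : e ∈ Kset := ⟨he1.trans_lt (by linarith), he2⟩
    have het : e ∈ φ.target := (hball e (hKρ e heK)).1
    have hq : φ.symm e ∈ V := hmemV.2 ⟨φ.map_target het, by rw [φ.right_inv het]; exact heK⟩
    refine ⟨hq, fun {l} hl ↦ ?_⟩
    have h1 : Tendsto (fun s : J ↦ γM s) l (𝓝 (φ.symm e)) := by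
      have h2 := ((continuousAt_extChartAt_symm'' het).tendsto).comp hl
      exact h2.congr fun s ↦ hleft s
    rw [nhds_subtype_eq_comap, tendsto_comap_iff]
    exact h1
  -- future side: the clock becomes nonnegative
  have hfut : ∃ s ∈ J, 0 ≤ h s := by
    rcases exists_clock_nonneg_or_hasFutureEndpoint hJ hJne (half_pos hc) hkpos.le hk2
      (x₀ := x₀) (Φ := F) (δ := δ) hFc hderiv hh hrate (fun s _ ↦ rfl)
      (fun s _ ↦ ⟨hKsub _ (hxcK s), (hxcK s).2⟩) with h1 | ⟨e, he1, he2, he3⟩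
    · exact h1
    · exfalso
      obtain ⟨hq, hT⟩ := hlim e he1 he2
      exact hγf.2 ⟨φ.symm e, hq⟩ (hT he3)
  -- past side: the clock becomes nonpositive (the reversed curve, clock `-f`)
  have hpast : ∃ s ∈ J, h s ≤ 0 := by
    have hJ' : (Neg.neg ⁻¹' J).OrdConnected := ordConnected_preimage_neg hJ
    have hJne' : (Neg.neg ⁻¹' J).Nonempty := by
      obtain ⟨s, hs⟩ := hJne; exact ⟨-s, by simpa using hs⟩
    have hx' : ∀ s ∈ Neg.neg ⁻¹' J, HasDerivAt (fun s ↦ xc (-s)) (-wc (-s)) s := fun s hs ↦ by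
      have h1 := (hderiv (-s) hs).scomp s (hasDerivAt_neg s)
      rw [neg_one_smul] at h1
      exact h1
    have hh' : ∀ s ∈ Neg.neg ⁻¹' J, HasDerivAt (fun s ↦ -h (-s)) (f' (xc (-s)) (wc (-s))) s :=
      fun s hs ↦ by
        have h1 := ((hh (-s) hs).comp s (hasDerivAt_neg s)).neg
        rw [mul_neg_one, neg_neg] at h1
        exact h1
    have hw' : ∀ s ∈ Neg.neg ⁻¹' J, c / 2 * ‖-wc (-s)‖ ≤ f' (xc (-s)) (wc (-s)) := fun s hs ↦ by
      rw [norm_neg]; exact hrate (-s) hs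
    rcases exists_clock_nonneg_or_hasFutureEndpoint hJ' hJne' (half_pos hc) hkpos.le hk2
      (x₀ := x₀) (Φ := fun x ↦ -F x) (δ := δ) hFc' hx' hh' hw' (fun s _ ↦ rfl)
      (fun s _ ↦ ⟨hKsub _ (hxcK (-s)), by rw [abs_neg]; exact (hxcK (-s)).2⟩)
      with ⟨s, hs, h1⟩ | ⟨e, he1, he2, he3⟩
    · exact ⟨-s, hs, by linarith⟩
    · exfalso
      rw [abs_neg] at he2
      obtain ⟨hq, hT⟩ := hlim e he1 he2
      have he4 : HasPastEndpoint xc J e := by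
        have h5 := (hasPastEndpoint_comp_neg_iff (γ := fun s ↦ xc (-s)) (s := Neg.neg ⁻¹' J)
          (p := e)).2 he3
        have hs : Neg.neg ⁻¹' (Neg.neg ⁻¹' J) = J := by ext t; simp
        simp only [neg_neg] at h5
        rwa [hs] at h5
      exact hγp.2 ⟨φ.symm e, hq⟩ (hT he4)
  -- the crossing, by the intermediate value theorem, and its uniqueness
  obtain ⟨s₁, hs₁, h₁⟩ := hfut
  obtain ⟨s₂, hs₂, h₂⟩ := hpast
  have hsub : uIcc s₂ s₁ ⊆ J := hJ.uIcc_subset hs₂ hs₁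
  obtain ⟨t, ht, ht0⟩ : ∃ t ∈ uIcc s₂ s₁, h t = 0 :=
    intermediate_value_uIcc (hcont.mono hsub) ⟨inf_le_left.trans h₂, h₁.trans le_sup_right⟩
  have htJ : t ∈ J := hsub ht
  have hslice : ∀ s, (γM s ∈ S ↔ f (γM s) = 0) := fun s ↦ by
    have h := (hball (xc s) (hxcρ s)).2.2.2.2.2.2
    rwa [hleft] at h
  refine ⟨t, ⟨htJ, (hslice t).2 (by rw [← hhf]; exact ht0)⟩, fun t' ht' ↦ ?_⟩
  have h0 : h t' = 0 := by rw [hhf]; exact (hslice t').1 ht'.2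
  exact hmono.injOn ht'.1 htJ (h0.trans ht0.symm)

end LorentzianMetric


end Literature.Geometry.Lorentzian

end
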